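import Mathlib
import Literature.NumberTheory.LFunctions.XiMoments
import Literature.MeasureTheory.Integral.HausdorffMomentLogConvex

/-!
# Wang–Yang (2024), Conjecture 1.10: complete monotonicity of the Taylor coefficients of `Ξ` — refuted

L. X. W. Wang and N. N. Y. Yang, *Laguerre inequalities and complete monotonicity for the Riemann
Xi-function and the partition function*, Trans. Amer. Math. Soc. **377** (2024), 4703–4725,
doi:10.1090/tran/9081 [WangYang2024], conjecture (Conjecture 1.10, quoted from the authors' accepted
manuscript; the journal text is not held, acquisition request acq-07479) that the Taylor
coefficients `γ(n)` of the Riemann Xi-function form a COMPLETELY MONOTONE sequence: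
`(-1)^r Δ^r γ(n) > 0` for all positive integers `r` and `n`, `Δγ(n) = γ(n+1) - γ(n)`.

Here `γ(n) = n! b_n / (2n)!` with the moments `b_n = ∫₀^∞ t^{2n} Φ(t) dt` of the Jacobi-theta
(Pólya–de Bruijn) kernel `Φ` (Csordas–Norfolk–Varga 1986, (1.3)–(1.5); Csordas 2015, (4.1)–(4.4):
`ξ(x/2)/8 = ∫₀^∞ Φ(t) cos(xt) dt = ∑ (-1)^k b_k x^{2k}/(2k)!`); in the tree `Φ = deBruijnPhi` and
`b_n = xiMoment (2n)` (`Literature.NumberTheory.LFunctions.xiMoment`, Rodgers–Tao normalisation, the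
same series), and the Griffin–Ono–Rolen–Zagier coefficients are `xiTaylorCoeff n = 64 · 4ⁿ · γ(n)`
(`xiTaylorCoeff_eq_xiMoment`).

**The conjecture is false, in every normalisation.** A completely monotone sequence is a Hausdorff
moment sequence and hence log-convex (`Literature.MeasureTheory.Integral.sq_le_mul_of_fwdDiff_alternating`),
whereas the `γ(n)` are strictly LOG-CONCAVE: `γ(m)² > γ(m-1) γ(m+1)` for all `m ≥ 1` is exactly the
system of Turán inequalities `b_m² > (2m-1)/(2m+1) · b_{m-1} b_{m+1}` PROVED by Csordas, Norfolk and
Varga (Trans. AMS 296 (1986), Theorem 2.5, (2.26); analytically for `m ≥ 2`, (2.30), and by a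
certified computation for `m = 1`, (2.31)) — carried here as the cited named fact
`TuranInequalities`. So no three consecutive terms of `C · cⁿ · γ(n)` (`C, c > 0`) are compatible
with complete monotonicity; refuting Conjecture 1.10 needs only the case `m = 2` (`γ(2)² > γ(1) γ(3)`).

* `b`, `gamma` — the moments and the coefficients `γ(n) = n! b_n/(2n)!`;
* `TuranInequalities` — CNV 1986, Thm. 2.5 (named fact, hypothesis of the refutation);
* `gamma_mul_lt_sq` — `γ(k) γ(k+2) < γ(k+1)²` from the Turán inequalities (Csordas 2015, (4.5));
* `Statement110` — the printed statement, Conjecture 1.10 (a tombstone: refuted below, no `_holds`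
  can exist);
* `statement110_false` — `TuranInequalities → ¬ Statement110`;
* `not_completelyMonotone_scaled`, `not_completelyMonotone_xiTaylorCoeff` — no tail of
  `C cⁿ γ(n)`, in particular of the GORZ coefficients `xiTaylorCoeff`, is completely monotone.

AI-produced formalisation for the refutations bundle `papers/_cross/refutations`, item (xii); AI review
is weaker than expert review.

## References

* L. X. W. Wang, N. N. Y. Yang, Trans. Amer. Math. Soc. 377 (2024) 4703–4725, Conjecture 1.10.
  [WangYang2024]
* G. Csordas, T. S. Norfolk, R. S. Varga, *The Riemann hypothesis and the Turán inequalities*,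
  Trans. Amer. Math. Soc. 296 (1986) 521–541, (1.3)–(1.5), (1.8), Theorem 2.5 (2.26), (2.30), (2.31).
  [CsordasNorfolkVarga1986]
* G. Csordas, *Fourier transforms of positive definite kernels and the Riemann ξ-function*,
  Comput. Methods Funct. Theory 15 (2015) 37–58, arXiv:1309.0055, (4.1)–(4.5). [Csordas2015]
* M. Griffin, K. Ono, L. Rolen, D. Zagier, PNAS 116 (2019) 11103–11110, eq. (1). [GORZPNAS2019]
-/

noncomputable section

open MeasureTheory Set
open scoped Nat

namespace Literature.NumberTheory.LFunctions.WangYang2024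

/-- The moments `b_m = ∫₀^∞ t^{2m} Φ(t) dt` (`m = 0, 1, …`) of the Jacobi-theta kernel `Φ`
(CNV (1.3), "without the usual factor 4"): in the tree `Φ = deBruijnPhi` and `b_m = xiMoment (2m)`.
[cite: CsordasNorfolkVarga1986, (1.5)] -/
def b (m : ℕ) : ℝ := xiMoment (2 * m)

/-- The Taylor coefficients `γ(k) = k! b_k / (2k)!` of `F(x) = ∑ γ_k xᵏ/k!`, where
`ξ(x/2)/8 = ∑ (-1)^k b_k x^{2k}/(2k)!` (Csordas 2015, (4.1), (4.4); CNV 1986, (1.4)–(1.6)).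
[cite: Csordas2015, (4.4)] -/
def gamma (k : ℕ) : ℝ := (k ! : ℝ) * b k / ((2 * k)! : ℝ)

/-- `b_m > 0` (`Φ > 0` on `[0, ∞)`; CNV Theorem A (i)). [folklore] -/
theorem b_pos (m : ℕ) : 0 < b m := xiMoment_pos _

/-- `γ(k) > 0`. [folklore] -/
theorem gamma_pos (k : ℕ) : 0 < gamma k := by
  have h1 : (0 : ℝ) < k ! := by exact_mod_cast Nat.factorial_pos k
  have h2 : (0 : ℝ) < (2 * k)! := by exact_mod_cast Nat.factorial_pos (2 * k)
  have h3 := b_pos k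
  unfold gamma
  positivity

/-- **The Turán inequalities for `Ξ`** (Csordas–Norfolk–Varga 1986, Theorem 2.5, (2.26) = (1.8);
Pólya's problem of 1927): `b_m² > ((2m-1)/(2m+1)) b_{m-1} b_{m+1}` for `m = 1, 2, 3, …`. Proved
analytically for `m ≥ 2` ((2.30), from the strict log-concavity of the Mellin moments `λ_x`,
Prop. 2.4) and for `m = 1` by a computation with rigorous error bounds ((2.31):
`b_1² - b_0 b_2/3 = 3.5884…·10⁻⁸ > 0`, §4). Named fact; not reproved here.
[cite: CsordasNorfolkVarga1986, Theorem 2.5] -/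
def TuranInequalities : Prop :=
  ∀ m : ℕ, 1 ≤ m → (2 * m - 1 : ℝ) / (2 * m + 1) * b (m - 1) * b (m + 1) < b m ^ 2

/-- **Strict log-concavity of `γ`**: the Turán inequality at `m = k + 1` is equivalent to
`γ(k) γ(k+2) < γ(k+1)²` (Csordas 2015, (4.5): `T_m = γ_m² - γ_{m-1} γ_{m+1}`), because
`(k+1)!² (2k)! (2k+4)! / (k! (k+2)! (2k+2)!²) = (2k+3)/(2k+1)`. [cite: Csordas2015, (4.5)] -/
theorem gamma_mul_lt_sq (h : TuranInequalities) (k : ℕ) :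
    gamma k * gamma (k + 2) < gamma (k + 1) ^ 2 := by
  -- the Turán inequality at `m = k + 1`, cleared of its denominator
  have hT : (2 * k + 1 : ℝ) * (b k * b (k + 2)) < (2 * k + 3) * b (k + 1) ^ 2 := by
    have h0 := h (k + 1) (Nat.succ_le_succ (Nat.zero_le k))
    rw [Nat.add_sub_cancel] at h0
    push_cast at h0
    have hpos : (0 : ℝ) < 2 * (k + 1) + 1 := by positivity
    rw [div_mul_eq_mul_div, div_mul_eq_mul_div, div_lt_iff₀ hpos] at h0
    nlinarith [h0]
  -- factorials
  have f1 : ((k + 1)! : ℝ) = (k + 1) * k ! := by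
    rw [Nat.factorial_succ]; push_cast; ring
  have f2 : ((k + 2)! : ℝ) = (k + 2) * (k + 1) * k ! := by
    rw [show k + 2 = k + 1 + 1 from rfl, Nat.factorial_succ, Nat.factorial_succ]; push_cast; ring
  have f3 : ((2 * (k + 1))! : ℝ) = (2 * k + 2) * (2 * k + 1) * (2 * k)! := by
    rw [show 2 * (k + 1) = 2 * k + 1 + 1 by ring, Nat.factorial_succ, Nat.factorial_succ]
    push_cast; ring
  have f4 : ((2 * (k + 2))! : ℝ) = (2 * k + 4) * (2 * k + 3) * (2 * k + 2) * (2 * k + 1) * (2 * k)! := by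
    rw [show 2 * (k + 2) = 2 * k + 1 + 1 + 1 + 1 by ring, Nat.factorial_succ, Nat.factorial_succ,
      Nat.factorial_succ, Nat.factorial_succ]
    push_cast; ring
  have hk : (k ! : ℝ) ≠ 0 := by positivity
  have h2k : ((2 * k)! : ℝ) ≠ 0 := by positivity
  have hA : (2 * (k : ℝ) + 1) ≠ 0 := by positivity
  have hB : (2 * (k : ℝ) + 2) ≠ 0 := by positivity
  have hC : (2 * (k : ℝ) + 3) ≠ 0 := by positivity
  have hD : (2 * (k : ℝ) + 4) ≠ 0 := by positivity
  -- `γ(k) = r b_k`, `2(2k+1) γ(k+1) = r b_{k+1}`, `4(2k+1)(2k+3) γ(k+2) = r b_{k+2}`, `r = k!/(2k)!`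
  set r : ℝ := (k ! : ℝ) / ((2 * k)! : ℝ) with hr_def
  have hr : 0 < r := by positivity
  have e0 : gamma k = r * b k := by
    simp only [gamma, hr_def]; ring
  have e1 : 2 * (2 * k + 1) * gamma (k + 1) = r * b (k + 1) := by
    simp only [gamma, hr_def]
    rw [f1, f3]
    field_simp
  have e2 : 4 * (2 * k + 1) * (2 * k + 3) * gamma (k + 2) = r * b (k + 2) := by
    simp only [gamma, hr_def]
    rw [f2, f4]
    field_simp
    ring
  have H : 16 * (2 * k + 1) ^ 2 * (2 * k + 3) * (gamma k * gamma (k + 2)) <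
      16 * (2 * k + 1) ^ 2 * (2 * k + 3) * gamma (k + 1) ^ 2 := by
    calc 16 * (2 * k + 1) ^ 2 * (2 * k + 3) * (gamma k * gamma (k + 2))
        = 4 * (2 * k + 1) * (r * b k) * (r * b (k + 2)) := by rw [e0, ← e2]; ring
      _ < 4 * (2 * k + 3) * (r * b (k + 1)) ^ 2 := by
          nlinarith [mul_pos (mul_pos hr hr) (sub_pos.2 hT)]
      _ = 16 * (2 * k + 1) ^ 2 * (2 * k + 3) * gamma (k + 1) ^ 2 := by rw [← e1]; ring
  exact lt_of_mul_lt_mul_left H (by positivity)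

/-- **Wang–Yang (2024), Statement 1.10** (labelled Conj. 1.10 there), as printed:
"`(-1)^r Δ^r γ(n) > 0` for all positive integers `r` and `n`" — the sequence of Taylor coefficients
`γ(n)` of the Riemann Xi-function is completely monotone (`Δ` the forward difference in `n`,
Mathlib's `fwdDiff 1`). **REFUTED in this file** (`statement110_false`, from the Turán inequalities of
Csordas–Norfolk–Varga; and in every normalisation `C cⁿ γ(n)`, `not_completelyMonotone_scaled`):
kept as a cited definition because the refutation names it; no `_holds` can exist. Wording quoted from
the accepted manuscript; not yet compared with the journal text (acq-07479).
[cite: WangYang2024, Conj. 1.10] -/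
def Statement110 : Prop :=
  ∀ r n : ℕ, 1 ≤ r → 1 ≤ n → 0 < (-1 : ℝ) ^ r * (fwdDiff 1)^[r] gamma n

/-- **Statement 1.10 of Wang–Yang is false** (given the Turán inequalities, CNV 1986, Thm. 2.5):
with `γ > 0` the statement makes the tail `k ↦ γ(k+1)` completely monotone, hence log-convex
(`sq_le_mul_of_fwdDiff_alternating`: Hausdorff's moment theorem and Cauchy–Schwarz), so
`γ(2)² ≤ γ(1) γ(3)` — contradicting `γ(1) γ(3) < γ(2)²` (`gamma_mul_lt_sq`, the case `m = 2`).
[folklore] -/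
theorem statement110_false (h : TuranInequalities) : ¬ Statement110 := by
  intro h110
  have hCM : ∀ r k : ℕ, 0 ≤ (-1 : ℝ) ^ r * (fwdDiff 1)^[r] (fun j => gamma (j + 1)) k := by
    intro r k
    rw [fwdDiff_iter_comp_add]
    rcases Nat.eq_zero_or_pos r with rfl | hr
    · simpa using (gamma_pos (k + 1)).le
    · exact (h110 r (k + 1) hr (Nat.succ_pos k)).le
  have hlc : gamma 2 ^ 2 ≤ gamma 1 * gamma 3 := by
    simpa using Literature.MeasureTheory.Integral.sq_le_mul_of_fwdDiff_alternating _ hCM 0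
  have hstrict : gamma 1 * gamma 3 < gamma 2 ^ 2 := gamma_mul_lt_sq h 1
  exact absurd hlc (not_le.mpr hstrict)

/-- **No tail of any rescaling `C · cⁿ · γ(n)` (`C, c > 0`) is completely monotone**: complete
monotonicity of `k ↦ C c^{n₀+k} γ(n₀+k)` would give log-convexity at `n₀, n₀+1, n₀+2`, i.e.
`γ(n₀+1)² ≤ γ(n₀) γ(n₀+2)` after cancelling `C² c^{2n₀+2} > 0`, against the Turán inequality at
`m = n₀ + 1`. (This makes the refutation independent of the normalisation of `γ` chosen in the
primary text.) [folklore] -/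
theorem not_completelyMonotone_scaled (h : TuranInequalities) {C c : ℝ} (hC : 0 < C) (hc : 0 < c)
    (n₀ : ℕ) :
    ¬ ∀ r k : ℕ, 0 ≤ (-1 : ℝ) ^ r * (fwdDiff 1)^[r] (fun j => C * c ^ (n₀ + j) * gamma (n₀ + j)) k := by
  intro hCM
  have hlc := Literature.MeasureTheory.Integral.sq_le_mul_of_fwdDiff_alternating _ hCM 0
  simp only [add_zero] at hlc
  have hstrict := gamma_mul_lt_sq h n₀
  have hP : 0 < C ^ 2 * c ^ n₀ * c ^ (n₀ + 2) := by positivity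
  have e1 : (C * c ^ (n₀ + 1) * gamma (n₀ + 1)) ^ 2 =
      C ^ 2 * c ^ n₀ * c ^ (n₀ + 2) * gamma (n₀ + 1) ^ 2 := by ring
  have e2 : C * c ^ n₀ * gamma n₀ * (C * c ^ (n₀ + 2) * gamma (n₀ + 2)) =
      C ^ 2 * c ^ n₀ * c ^ (n₀ + 2) * (gamma n₀ * gamma (n₀ + 2)) := by ring
  rw [e1, e2] at hlc
  exact absurd (le_of_mul_le_mul_left hlc hP) (not_le.mpr hstrict)

/-- **The Griffin–Ono–Rolen–Zagier coefficients are not completely monotone on any tail**: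
`xiTaylorCoeff n = 64 · 4ⁿ · γ(n)` (`xiTaylorCoeff_eq_xiMoment`), so `not_completelyMonotone_scaled`
applies with `C = 64`, `c = 4`. [folklore] -/
theorem not_completelyMonotone_xiTaylorCoeff (h : TuranInequalities) (n₀ : ℕ) :
    ¬ ∀ r k : ℕ, 0 ≤ (-1 : ℝ) ^ r * (fwdDiff 1)^[r] (fun j => xiTaylorCoeff (n₀ + j)) k := by
  have e : (fun j => xiTaylorCoeff (n₀ + j)) = fun j => 64 * 4 ^ (n₀ + j) * gamma (n₀ + j) := by
    funext j
    rw [xiTaylorCoeff_eq_xiMoment]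
    simp only [gamma, b]
    ring
  rw [e]
  exact not_completelyMonotone_scaled h (by norm_num) (by norm_num) n₀

/-- The refutation in the alternating-sum form of complete monotonicity
(`∑_{i ≤ k} (-1)^i C(k,i) γ(n+i) ≥ 0` for all `n ≥ 1`, `k`), the form of Hausdorff's theorem in the
tree. [folklore] -/
theorem not_alternating_tail (h : TuranInequalities) :
    ¬ ∀ n k : ℕ, 0 ≤ ∑ i ∈ Finset.range (k + 1),
      (-1 : ℝ) ^ i * (k.choose i : ℝ) * gamma (n + 1 + i) := by
  intro hCM
  have hlc : gamma 2 ^ 2 ≤ gamma 1 * gamma 3 := by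
    simpa using Literature.MeasureTheory.Integral.sq_le_mul_of_alternating (fun j => gamma (j + 1))
      (fun n k => by simpa [add_right_comm] using hCM n k) 0
  exact absurd hlc (not_le.mpr (gamma_mul_lt_sq h 1))

end Literature.NumberTheory.LFunctions.WangYang2024

end
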